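import Mathlib.NumberTheory.Harmonic.ZetaAsymp
import Mathlib.NumberTheory.LSeries.ZetaZeros
import Mathlib.Analysis.Real.Pi.Bounds
import Mathlib.Analysis.Complex.JensenFormula
import Literature.Analysis.Complex.LogDerivZerosDisc
import Literature.NumberTheory.LFunctions.ZetaZeros
import Literature.NumberTheory.LFunctions.ZetaZerosJensen
import Literature.NumberTheory.LFunctions.ZetaFractionalPartIntegral
import HarnessLib

/-!
# `ζ'/ζ` near the critical strip: the local partial fraction (Montgomery–Vaughan Lemma 12.1, right half)

Trunk T-ANT (`NumberTheory/LFunctions`), family RH. Montgomery–Vaughan, *Multiplicative Number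
Theory I*, Lemma 12.1: "if `|t − ℑρ| > 1` for all zeros `ρ`… uniformly for `−1 ≤ σ ≤ 2`,
`ζ'/ζ(s) = −1/(s−1) + ∑_{|γ − t| ≤ 1} 1/(s − ρ) + O(log τ)`", `τ = |t| + 4`; their Lemma 6.4 is the
same statement on `5/6 ≤ σ ≤ 2` with the sum over the zeros in the disc `|ρ − (3/2 + it)| ≤ 5/6`.
Both come from the local lemma on `f'/f` (Titchmarsh §3.9 Lemma α = MV Lemma 6.3), which the tree
has for functions holomorphic on a closed disc: `Literature.Analysis.Complex.norm_logDeriv_sub_sum_le`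
(`Literature/Analysis/Complex/LogDerivZerosDisc.lean`). Here we specialise it to the entire function
`ζ₁(s) = (s − 1)ζ(s)` (Mathlib's `riemannZeta₁`; `ζ₁'/ζ₁ = ζ'/ζ + 1/(s − 1)`) on the discs
`|s − (2 + it)| ≤ 7/4 < 9/5 < 37/20 < 39/20`, which stay in `σ ≥ 1/20` where
`‖ζ₁(s)‖ ≤ ‖s‖ + ‖s‖‖s−1‖/σ` (`Literature.NumberTheory.LFunctions.norm_riemannZeta₁_le_of_re_pos`, Titchmarsh (2.12.2)); working
with `ζ₁` removes the pole and any restriction on `t`. Results, for **all real `t`**: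

* `Literature.RH.zetaDiscZeros t` — the finite set of zeros of `ζ` in `|s − (2 + it)| ≤ 37/20` (support of
  the divisor of `ζ₁`), with `Literature.NumberTheory.LFunctions.mem_zetaDiscZeros`, and the identification of the weights with
  the tree's multiplicity `Literature.NumberTheory.LFunctions.riemannZetaZeroOrder` (`Literature.NumberTheory.LFunctions.zetaDiscDivisor_eq_riemannZetaZeroOrder`);
* `Literature.NumberTheory.LFunctions.exists_sum_riemannZetaZeroOrder_le_of_subset_closedBall` — Jensen: the zeros in
  `|s − (2 + it)| ≤ R` (`R < 39/20`), with multiplicity, number `≤ C(R) log(|t| + 4)`;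
* `Literature.NumberTheory.LFunctions.exists_norm_logDeriv_riemannZeta₁_sub_sum_le` — **Lemma 12.1, disc form**: an absolute
  `C` with `‖ζ₁'/ζ₁(s) − ∑_{ρ ∈ zetaDiscZeros t} m(ρ)/(s − ρ)‖ ≤ C log(|t| + 4)` for
  `|s − (2 + it)| ≤ 7/4` (this covers `1/4 ≤ σ ≤ 2` at height `t`), `ζ₁(s) ≠ 0` (i.e. `ζ(s) ≠ 0`
  or `s = 1`).

The lower bound at the centre is `‖ζ(2 + it)‖ ≥ 2 − π²/6`
(`Literature.NumberTheory.LFunctions.two_sub_pi_sq_div_six_le_norm_riemannZeta_two_add`, `ZetaZerosJensen.lean`, which develops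
the Jensen count of the windows `β ≥ 1/4`; the present file adds the log-derivative estimate on the
same discs).

## References

* H. L. Montgomery, R. C. Vaughan, *Multiplicative Number Theory I. Classical Theory*, CUP 2007,
  Lemmas 6.3, 6.4, 12.1, Thm. 10.13.
* E. C. Titchmarsh, *The Theory of the Riemann Zeta-Function*, 2nd ed., OUP 1986, §3.9 Lemma α,
  Thm. 9.2, Thm. 9.6 (A).
-/

noncomputable section

open Complex Set Metric Filter Topology MeromorphicOn Real

namespace Literature.NumberTheory.LFunctions

/-! ### `ζ₁ = (s − 1)ζ(s)`: zeros, orders -/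

/-- Away from `s = 1`, `ζ₁(s) = (s − 1) ζ(s)`. [folklore] -/
theorem riemannZeta₁_eq_mul {s : ℂ} (hs : s ≠ 1) : riemannZeta₁ s = (s - 1) * riemannZeta s := by
  rw [riemannZeta_eq_inv_sub_mul hs, ← mul_assoc, mul_inv_cancel₀ (sub_ne_zero.mpr hs), one_mul]

/-- Away from `s = 1`, `ζ₁(s) = 0 ↔ ζ(s) = 0`. [folklore] -/
theorem riemannZeta₁_eq_zero_iff {s : ℂ} (hs : s ≠ 1) : riemannZeta₁ s = 0 ↔ riemannZeta s = 0 := by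
  rw [riemannZeta₁_eq_mul hs, mul_eq_zero, sub_eq_zero, or_iff_right hs]

/-- `ζ₁(1) = 1 ≠ 0`; hence `ζ₁(s) = 0 → s ≠ 1`. [folklore] -/
theorem ne_one_of_riemannZeta₁_eq_zero {s : ℂ} (h : riemannZeta₁ s = 0) : s ≠ 1 := by
  rintro rfl
  simp at h

/-- A zero of `ζ₁` is a zero of `ζ`. [folklore] -/
theorem riemannZeta_eq_zero_of_riemannZeta₁ {s : ℂ} (h : riemannZeta₁ s = 0) : riemannZeta s = 0 :=
  (riemannZeta₁_eq_zero_iff (ne_one_of_riemannZeta₁_eq_zero h)).1 h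

/-- `ζ₁` has finite order everywhere (it is entire and `ζ₁(1) = 1`). [folklore] -/
theorem analyticOrderAt_riemannZeta₁_ne_top (ρ : ℂ) : analyticOrderAt riemannZeta₁ ρ ≠ ⊤ := by
  intro htop
  have h0 : riemannZeta₁ =ᶠ[𝓝 ρ] 0 := analyticOrderAt_eq_top.mp htop
  have hall : AnalyticOnNhd ℂ riemannZeta₁ univ := fun z _ ↦ differentiable_riemannZeta₁.analyticAt z
  have := hall.eqOn_zero_of_preconnected_of_eventuallyEq_zero isPreconnected_univ (mem_univ ρ) h0
    (mem_univ 1)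
  simp at this

/-- Away from `s = 1`, `ζ₁` and `ζ` have the same meromorphic order. [folklore] -/
theorem meromorphicOrderAt_riemannZeta₁_eq {u : ℂ} (hu : u ≠ 1) :
    meromorphicOrderAt riemannZeta₁ u = meromorphicOrderAt riemannZeta u := by
  have hev : riemannZeta₁ =ᶠ[𝓝 u] (fun s : ℂ ↦ s - 1) * riemannZeta := by
    filter_upwards [isOpen_ne.mem_nhds hu] with s hs
    rw [Pi.mul_apply, riemannZeta₁_eq_mul hs]
  rw [meromorphicOrderAt_congr (hev.filter_mono nhdsWithin_le_nhds)]
  exact meromorphicOrderAt_mul_of_ne_zero (by fun_prop) (sub_ne_zero.mpr hu)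

/-- The multiplicity of `ζ₁` at `ρ ≠ 1` (Mathlib's `analyticOrderNatAt`) is the tree's
`m(ρ) = riemannZetaZeroOrder ρ`. [folklore] -/
theorem analyticOrderNatAt_riemannZeta₁_eq {ρ : ℂ} (hρ : ρ ≠ 1) :
    ((analyticOrderNatAt riemannZeta₁ ρ : ℕ) : ℤ) = riemannZetaZeroOrder ρ := by
  rw [riemannZetaZeroOrder, ← meromorphicOrderAt_riemannZeta₁_eq hρ,
    (differentiable_riemannZeta₁.analyticAt ρ).meromorphicOrderAt_eq,
    ← Nat.cast_analyticOrderNatAt (analyticOrderAt_riemannZeta₁_ne_top ρ)]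
  simp

/-- `ζ'/ζ = ζ₁'/ζ₁ − 1/(s − 1)` where both make sense (`s ≠ 1`, `ζ(s) ≠ 0`). [folklore] -/
theorem logDeriv_riemannZeta_eq {s : ℂ} (hs : s ≠ 1) (hζ : riemannZeta s ≠ 0) :
    logDeriv riemannZeta s = logDeriv riemannZeta₁ s - (s - 1)⁻¹ := by
  have hev : riemannZeta₁ =ᶠ[𝓝 s] fun w ↦ (w - 1) * riemannZeta w := by
    filter_upwards [isOpen_ne.mem_nhds hs] with w hw
    exact riemannZeta₁_eq_mul hw
  have h1 : logDeriv riemannZeta₁ s = logDeriv (fun w ↦ (w - 1) * riemannZeta w) s := by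
    rw [logDeriv_apply, logDeriv_apply, hev.deriv_eq, hev.eq_of_nhds]
  rw [h1, logDeriv_mul (f := fun w : ℂ ↦ w - 1) (g := riemannZeta) s (sub_ne_zero.2 hs) hζ
    (by fun_prop) (differentiableAt_riemannZeta hs)]
  have : logDeriv (fun w : ℂ ↦ w - 1) s = (s - 1)⁻¹ := by
    rw [logDeriv_apply, deriv_sub_const, deriv_id'', one_div]
  rw [this]
  ring

/-! ### The discs `|s − (2 + it)| ≤ r`, `r < 39/20` -/

/-- Points of the disc `|z − (2 + it)| ≤ 39/20` have `‖z − 1‖ ≤ |t| + 4` (companion of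
`Literature.NumberTheory.LFunctions.jensenDisc_re_ge`, `Literature.NumberTheory.LFunctions.jensenDisc_norm_le` in `ZetaZerosJensen.lean`). [folklore] -/
lemma jensenDisc_norm_sub_one_le (t : ℝ) {z : ℂ} (hz : z ∈ closedBall (2 + t * I) (39 / 20)) :
    ‖z - 1‖ ≤ |t| + 4 := by
  rw [mem_closedBall, dist_eq_norm] at hz
  have h1 : ‖z - 1‖ ≤ ‖z - (2 + t * I)‖ + ‖(2 + t * I : ℂ) - 1‖ := by
    have := norm_add_le (z - (2 + t * I)) (2 + t * I - 1)
    rwa [sub_add_sub_cancel] at this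
  have h2 : ‖(2 + t * I : ℂ) - 1‖ ≤ 1 + |t| := by
    rw [show (2 + t * I : ℂ) - 1 = 1 + t * I by ring]
    refine (norm_add_le _ _).trans ?_
    simp
  linarith

/-- Growth of `ζ₁` on the disc `|s − (2 + it)| ≤ 39/20`: `‖ζ₁(s)‖ ≤ 21 (|t| + 4)²`
(from `‖ζ₁(s)‖ ≤ ‖s‖ + ‖s‖‖s − 1‖/Re s`, Titchmarsh (2.12.2), and `Re s ≥ 1/20`). [folklore] -/
theorem norm_riemannZeta₁_le_of_mem_closedBall (t : ℝ) {z : ℂ}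
    (hz : z ∈ closedBall (2 + t * I) (39 / 20)) : ‖riemannZeta₁ z‖ ≤ 21 * (|t| + 4) ^ 2 := by
  have hre := jensenDisc_re_ge hz
  have hz1 := jensenDisc_norm_le hz
  have hz2 := jensenDisc_norm_sub_one_le t hz
  have hre0 : 0 < z.re := by linarith
  have ht4 : 1 ≤ |t| + 4 := by linarith [abs_nonneg t]
  calc ‖riemannZeta₁ z‖ ≤ ‖z‖ + ‖z‖ * ‖z - 1‖ / z.re := norm_riemannZeta₁_le_of_re_pos hre0
    _ ≤ (|t| + 4) + (|t| + 4) * (|t| + 4) / (1 / 20) := by gcongr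
    _ = (|t| + 4) + 20 * (|t| + 4) ^ 2 := by ring
    _ ≤ (|t| + 4) ^ 2 + 20 * (|t| + 4) ^ 2 := by nlinarith
    _ = 21 * (|t| + 4) ^ 2 := by ring

/-- `2 − π²/6 > 0`. [folklore] -/
theorem two_sub_pi_sq_div_six_pos : 0 < 2 - π ^ 2 / 6 := by
  have := Real.pi_lt_d2
  have h0 := Real.pi_pos
  nlinarith

/-- `‖ζ₁(2 + it)‖ ≥ 2 − π²/6` (`‖1 + it‖ ≥ 1` and `‖ζ(2 + it)‖ ≥ 2 − π²/6`,
`two_sub_pi_sq_div_six_le_norm_riemannZeta_two_add`). [folklore] -/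
theorem two_sub_pi_sq_div_six_le_norm_riemannZeta₁_two_add (t : ℝ) :
    2 - π ^ 2 / 6 ≤ ‖riemannZeta₁ (2 + t * I)‖ := by
  set c : ℂ := 2 + t * I with hc
  have hc1 : c ≠ 1 := by
    intro h
    have := congrArg re h
    simp [hc] at this
  have hnorm : 1 ≤ ‖c - 1‖ := by
    have h1 : (c - 1).re = 1 := by simp [hc]; norm_num
    have := abs_re_le_norm (c - 1)
    rwa [h1, abs_one] at this
  rw [riemannZeta₁_eq_mul hc1, norm_mul]
  calc 2 - π ^ 2 / 6 = 1 * (2 - π ^ 2 / 6) := by ring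
    _ ≤ ‖c - 1‖ * ‖riemannZeta c‖ :=
        mul_le_mul hnorm (two_sub_pi_sq_div_six_le_norm_riemannZeta_two_add t)
          two_sub_pi_sq_div_six_pos.le (norm_nonneg _)

/-- `ζ₁(2 + it) ≠ 0`. [folklore] -/
theorem riemannZeta₁_two_add_ne_zero (t : ℝ) : riemannZeta₁ (2 + t * I) ≠ 0 := by
  intro h
  have := two_sub_pi_sq_div_six_le_norm_riemannZeta₁_two_add t
  rw [h, norm_zero] at this
  linarith [two_sub_pi_sq_div_six_pos]

/-- `log(21(|t|+4)²/‖ζ₁(2+it)‖) ≤ (|log(21/(2 − π²/6))| + 2) log(|t| + 4)`: the Jensen /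
Borel–Carathéodory quantity `L = log(M/|f(centre)|)` is `≪ log(|t| + 4)`. [folklore] -/
theorem log_bound_div_norm_le (t : ℝ) :
    Real.log (21 * (|t| + 4) ^ 2 / ‖riemannZeta₁ (2 + t * I)‖) ≤
      (|Real.log (21 / (2 - π ^ 2 / 6))| + 2) * Real.log (|t| + 4) := by
  set μ : ℝ := 2 - π ^ 2 / 6 with hμ
  have hμ0 : 0 < μ := two_sub_pi_sq_div_six_pos
  set c : ℂ := 2 + t * I with hc
  have ht4 : 4 ≤ |t| + 4 := by linarith [abs_nonneg t]
  have hlog4 : 1 ≤ Real.log (|t| + 4) := by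
    rw [← Real.log_exp 1]
    refine Real.log_le_log (Real.exp_pos 1) (le_trans ?_ ht4)
    have := Real.exp_one_lt_d9
    linarith
  have hne : riemannZeta₁ c ≠ 0 := riemannZeta₁_two_add_ne_zero t
  have hpos : 0 < ‖riemannZeta₁ c‖ := norm_pos_iff.mpr hne
  have h1 : Real.log (21 * (|t| + 4) ^ 2 / ‖riemannZeta₁ c‖) ≤
      Real.log (21 / μ) + 2 * Real.log (|t| + 4) := by
    have e : Real.log (21 / μ * (|t| + 4) ^ 2) = Real.log (21 / μ) + 2 * Real.log (|t| + 4) := by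
      rw [Real.log_mul (by positivity) (by positivity), Real.log_pow]
      push_cast
      ring
    rw [← e]
    refine Real.log_le_log (by positivity) ?_
    rw [div_mul_eq_mul_div, div_le_div_iff₀ hpos hμ0]
    have := two_sub_pi_sq_div_six_le_norm_riemannZeta₁_two_add t
    rw [← hc, ← hμ] at this
    nlinarith [sq_nonneg (|t| + 4)]
  refine h1.trans ?_
  rw [add_mul]
  gcongr
  calc Real.log (21 / μ) ≤ |Real.log (21 / μ)| := le_abs_self _
    _ = |Real.log (21 / μ)| * 1 := (mul_one _).symm
    _ ≤ |Real.log (21 / μ)| * Real.log (|t| + 4) := by gcongr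

/-! ### The zeros in the disc `|s − (2 + it)| ≤ 37/20` -/

/-- The divisor of `ζ₁` on the closed disc `|s − (2 + it)| ≤ 37/20` (Mathlib's
`MeromorphicOn.divisor`; it is `≥ 0` and supported on the zeros of `ζ` in the disc). [folklore] -/
def zetaDiscDivisor (t : ℝ) : Function.locallyFinsuppWithin (closedBall (2 + (t : ℂ) * I) (37 / 20)) ℤ :=
  divisor riemannZeta₁ (closedBall (2 + (t : ℂ) * I) (37 / 20))

/-- The zeros of `ζ` in the closed disc `|s − (2 + it)| ≤ 37/20`, each listed once: the (finite)
support of `zetaDiscDivisor t`. [folklore] -/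
def zetaDiscZeros (t : ℝ) : Finset ℂ :=
  ((zetaDiscDivisor t).finiteSupport (isCompact_closedBall _ _)).toFinset

/-- On the disc, the divisor of `ζ₁` at `u` is the tree's multiplicity `m(u) = riemannZetaZeroOrder u`
(`u ≠ 1`). [folklore] -/
theorem zetaDiscDivisor_eq_riemannZetaZeroOrder {t : ℝ} {u : ℂ}
    (hu : u ∈ closedBall (2 + (t : ℂ) * I) (37 / 20)) (hu1 : u ≠ 1) :
    zetaDiscDivisor t u = riemannZetaZeroOrder u := by
  have han : AnalyticOnNhd ℂ riemannZeta₁ (closedBall (2 + (t : ℂ) * I) (37 / 20)) :=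
    fun z _ ↦ differentiable_riemannZeta₁.analyticAt z
  rw [zetaDiscDivisor, divisor_apply han.meromorphicOn hu, meromorphicOrderAt_riemannZeta₁_eq hu1,
    riemannZetaZeroOrder]

/-- The divisor of `ζ₁` on the disc is non-negative. [folklore] -/
theorem zetaDiscDivisor_nonneg (t : ℝ) (u : ℂ) : 0 ≤ zetaDiscDivisor t u := by
  have han : AnalyticOnNhd ℂ riemannZeta₁ (closedBall (2 + (t : ℂ) * I) (37 / 20)) :=
    fun z _ ↦ differentiable_riemannZeta₁.analyticAt z
  exact han.divisor_nonneg u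

/-- **Membership.** `u ∈ zetaDiscZeros t` iff `u` lies in the disc `|u − (2 + it)| ≤ 37/20` and
`ζ₁(u) = 0` (equivalently `ζ(u) = 0`). [folklore] -/
theorem mem_zetaDiscZeros {t : ℝ} {u : ℂ} :
    u ∈ zetaDiscZeros t ↔ u ∈ closedBall (2 + (t : ℂ) * I) (37 / 20) ∧ riemannZeta₁ u = 0 := by
  rw [zetaDiscZeros, Set.Finite.mem_toFinset, Function.mem_support]
  constructor
  · intro h
    have hu : u ∈ closedBall (2 + (t : ℂ) * I) (37 / 20) :=
      (zetaDiscDivisor t).supportWithinDomain (Function.mem_support.2 h)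
    refine ⟨hu, ?_⟩
    have han : AnalyticOnNhd ℂ riemannZeta₁ (closedBall (2 + (t : ℂ) * I) (37 / 20)) :=
      fun z _ ↦ differentiable_riemannZeta₁.analyticAt z
    rw [zetaDiscDivisor, divisor_apply han.meromorphicOn hu,
      (differentiable_riemannZeta₁.analyticAt u).meromorphicOrderAt_eq] at h
    by_contra hne
    apply h
    rw [(differentiable_riemannZeta₁.analyticAt u).analyticOrderAt_eq_zero.2 hne]
    simp
  · rintro ⟨hu, h0⟩
    rw [zetaDiscDivisor_eq_riemannZetaZeroOrder hu (ne_one_of_riemannZeta₁_eq_zero h0)]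
    exact ((riemannZetaZeroOrder_pos_iff (ne_one_of_riemannZeta₁_eq_zero h0)).2
      (riemannZeta_eq_zero_of_riemannZeta₁ h0)).ne'

/-- Elements of `zetaDiscZeros t` are zeros of `ζ`, `≠ 1`, with `|Im ρ − t| ≤ 37/20`,
`Re ρ ≥ 3/20`, and their weight is `m(ρ) = riemannZetaZeroOrder ρ ≥ 1`. [folklore] -/
theorem zetaDiscZeros_prop {t : ℝ} {ρ : ℂ} (h : ρ ∈ zetaDiscZeros t) :
    riemannZeta ρ = 0 ∧ ρ ≠ 1 ∧ |ρ.im - t| ≤ 37 / 20 ∧ 3 / 20 ≤ ρ.re ∧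
      zetaDiscDivisor t ρ = riemannZetaZeroOrder ρ ∧ 1 ≤ riemannZetaZeroOrder ρ := by
  obtain ⟨h1, h2⟩ := mem_zetaDiscZeros.1 h
  have hz := riemannZeta_eq_zero_of_riemannZeta₁ h2
  have hne := ne_one_of_riemannZeta₁_eq_zero h2
  refine ⟨hz, hne, ?_, ?_, zetaDiscDivisor_eq_riemannZetaZeroOrder h1 hne,
    (riemannZetaZeroOrder_pos_iff hne).2 hz⟩
  · rw [mem_closedBall, dist_eq_norm] at h1
    have := abs_im_le_norm (ρ - (2 + t * I))
    simp only [sub_im, add_im, im_ofNat, mul_im, ofReal_re, I_im, mul_one, ofReal_im, I_re,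
      mul_zero, add_zero, zero_add] at this
    exact this.trans h1
  · rw [mem_closedBall, dist_eq_norm] at h1
    have := abs_re_le_norm (ρ - (2 + t * I))
    simp only [sub_re, add_re, re_ofNat, mul_re, ofReal_re, I_re, mul_zero, ofReal_im, I_im,
      mul_one, sub_self, add_zero] at this
    have := (abs_le.mp (this.trans h1)).1
    linarith

/-! ### Jensen counts -/

/-- **Jensen count in the discs `|s − (2 + it)| ≤ R`, `R < 39/20`** (Montgomery–Vaughan
Thm. 10.13, disc form; Titchmarsh Thm. 9.2): for `0 < R < 39/20` there is `C = C(R)` such that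
for every real `t` and every finite set `S` of zeros of `ζ` in the disc,
`∑_{ρ ∈ S} m(ρ) ≤ C log(|t| + 4)`, `m = riemannZetaZeroOrder`. [cite: MontgomeryVaughan2007, Thm. 10.13] -/
theorem exists_sum_riemannZetaZeroOrder_le_of_subset_closedBall {R : ℝ} (hR : 0 < R)
    (hR' : R < 39 / 20) :
    ∃ C : ℝ, 0 < C ∧ ∀ t : ℝ, ∀ S : Finset ℂ,
      (∀ u ∈ S, u ∈ closedBall (2 + (t : ℂ) * I) R ∧ riemannZeta u = 0) →
        ∑ ρ ∈ S, (riemannZetaZeroOrder ρ : ℝ) ≤ C * Real.log (|t| + 4) := by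
  set A₀ : ℝ := |Real.log (21 / (2 - π ^ 2 / 6))| + 2 with hA₀
  have hlog : 0 < Real.log ((39 : ℝ) / 20 / R) := Real.log_pos ((one_lt_div hR).2 hR')
  refine ⟨A₀ / Real.log ((39 : ℝ) / 20 / R), by positivity, fun t S hS ↦ ?_⟩
  classical
  set c : ℂ := 2 + t * I with hc
  have ht4 : 1 ≤ |t| + 4 := by linarith [abs_nonneg t]
  have hM : (1 : ℝ) ≤ 21 * (|t| + 4) ^ 2 := by nlinarith
  have han : AnalyticOnNhd ℂ riemannZeta₁ (closedBall c |(39 : ℝ) / 20|) :=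
    fun z _ ↦ differentiable_riemannZeta₁.analyticAt z
  have hJ := AnalyticOnNhd.sum_divisor_le (f := riemannZeta₁) (c := c) (r := R)
    (R := (39 : ℝ) / 20) (M := 21 * (|t| + 4) ^ 2) (by rwa [abs_of_pos hR])
    (by rwa [abs_of_pos hR, abs_of_pos (by norm_num : (0 : ℝ) < 39 / 20)]) hM han
    (riemannZeta₁_two_add_ne_zero t)
    (fun z hz ↦ norm_riemannZeta₁_le_of_mem_closedBall t (by
      rw [abs_of_pos (by norm_num : (0 : ℝ) < 39 / 20)] at hz
      exact sphere_subset_closedBall hz))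
  rw [abs_of_pos hR] at hJ
  -- the sum over `S` is at most the Jensen count
  set D := divisor riemannZeta₁ (closedBall c R) with hD
  have hanR : AnalyticOnNhd ℂ riemannZeta₁ (closedBall c R) :=
    fun z _ ↦ differentiable_riemannZeta₁.analyticAt z
  have hD0 : ∀ u, 0 ≤ D u := fun u ↦ hanR.divisor_nonneg u
  have hfin : (Function.support D).Finite := D.finiteSupport (isCompact_closedBall c R)
  have hSD : ∀ u ∈ S, riemannZetaZeroOrder u = D u := by
    intro u hu
    obtain ⟨huB, huz⟩ := hS u hu
    have hu1 := ne_one_of_riemannZeta_eq_zero huz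
    rw [hD, divisor_apply hanR.meromorphicOn huB, meromorphicOrderAt_riemannZeta₁_eq hu1,
      riemannZetaZeroOrder]
  have hle : ∑ u ∈ S, riemannZetaZeroOrder u ≤ ∑ᶠ u, D u := by
    rw [finsum_eq_sum_of_support_subset D (s := hfin.toFinset ∪ S) (by intro u hu; simp [hu])]
    calc ∑ u ∈ S, riemannZetaZeroOrder u = ∑ u ∈ S, D u := Finset.sum_congr rfl hSD
      _ ≤ ∑ u ∈ hfin.toFinset ∪ S, D u :=
          Finset.sum_le_sum_of_subset_of_nonneg Finset.subset_union_right fun u _ _ ↦ hD0 u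
  have hle' : (∑ u ∈ S, (riemannZetaZeroOrder u : ℝ)) ≤ ((∑ᶠ u, D u : ℤ) : ℝ) := by
    exact_mod_cast hle
  refine hle'.trans (hJ.trans ?_)
  rw [div_mul_eq_mul_div]
  exact div_le_div_of_nonneg_right (log_bound_div_norm_le t) hlog.le

/-- **Jensen count of the disc `|s − (2 + it)| ≤ 37/20`:** an absolute `C` with
`∑_{ρ ∈ zetaDiscZeros t} m(ρ) ≤ C log(|t| + 4)`, stated for the divisor weights
(`= riemannZetaZeroOrder`, `zetaDiscZeros_prop`). [cite: MontgomeryVaughan2007, Thm. 10.13] -/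
theorem exists_sum_zetaDiscZeros_le :
    ∃ C : ℝ, 0 < C ∧ ∀ t : ℝ,
      ∑ ρ ∈ zetaDiscZeros t, (zetaDiscDivisor t ρ : ℝ) ≤ C * Real.log (|t| + 4) := by
  obtain ⟨C, hC0, hC⟩ := exists_sum_riemannZetaZeroOrder_le_of_subset_closedBall
    (R := 37 / 20) (by norm_num) (by norm_num)
  refine ⟨C, hC0, fun t ↦ le_of_eq_of_le ?_ (hC t (zetaDiscZeros t) fun u hu ↦
    ⟨(mem_zetaDiscZeros.1 hu).1, (zetaDiscZeros_prop hu).1⟩)⟩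
  exact Finset.sum_congr rfl fun u hu ↦ by rw [(zetaDiscZeros_prop hu).2.2.2.2.1]

/-! ### The partial fraction of `ζ₁'/ζ₁` -/

/-- **Montgomery–Vaughan Lemma 12.1 / 6.4, disc form, all `t`.** There is an absolute constant
`C` such that for every real `t` and every `s` with `|s − (2 + it)| ≤ 7/4` (this covers
`1/4 ≤ σ ≤ 2` at height `t`) and `ζ₁(s) ≠ 0`,
`‖ζ₁'/ζ₁(s) − ∑_{ρ ∈ zetaDiscZeros t} m(ρ)/(s − ρ)‖ ≤ C log(|t| + 4)`,
where `ζ₁'/ζ₁ = ζ'/ζ + 1/(s−1)` (`logDeriv_riemannZeta_eq`) and `m(ρ)` is the divisor weight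
(`= riemannZetaZeroOrder ρ`, `zetaDiscZeros_prop`). MV: "`ζ'/ζ(s) = −1/(s−1) + ∑ 1/(s−ρ) + O(log τ)`".
(From `Literature.Analysis.Complex.norm_logDeriv_sub_sum_le` with radii `7/4 < 9/5 < 37/20 < 39/20`, the bound
`‖ζ₁‖ ≤ 21(|t|+4)²` on the disc, `‖ζ₁(2+it)‖ ≥ 2 − π²/6`, and the Jensen count.)
[cite: MontgomeryVaughan2007, Lemma 12.1] -/
theorem exists_norm_logDeriv_riemannZeta₁_sub_sum_le :
    ∃ C : ℝ, 0 < C ∧ ∀ t : ℝ, ∀ s ∈ closedBall (2 + (t : ℂ) * I) (7 / 4), riemannZeta₁ s ≠ 0 →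
      ‖logDeriv riemannZeta₁ s - ∑ ρ ∈ zetaDiscZeros t, (zetaDiscDivisor t ρ : ℂ) / (s - ρ)‖ ≤
        C * Real.log (|t| + 4) := by
  obtain ⟨C₂, hC₂0, hC₂⟩ := exists_sum_zetaDiscZeros_le
  set A₀ : ℝ := |Real.log (21 / (2 - π ^ 2 / 6))| + 2 with hA₀
  set K : ℝ := 2 * ((9 : ℝ) / 5) / ((37 / 20 - 9 / 5) * (9 / 5 - 7 / 4)) with hK
  set L₀ : ℝ := Real.log ((39 : ℝ) / 20 / (39 / 20 - 37 / 20)) with hL₀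
  have hK0 : 0 < K := by rw [hK]; norm_num
  have hL₀0 : 0 < L₀ := by rw [hL₀]; exact Real.log_pos (by norm_num)
  have hA₀0 : 0 < A₀ := by rw [hA₀]; positivity
  refine ⟨K * (A₀ + C₂ * L₀ + 1), by positivity, fun t s hs hζ ↦ ?_⟩
  have ht4 : 4 ≤ |t| + 4 := by linarith [abs_nonneg t]
  have hlog4 : 1 ≤ Real.log (|t| + 4) := by
    rw [← Real.log_exp 1]
    refine Real.log_le_log (Real.exp_pos 1) (le_trans ?_ ht4)
    have := Real.exp_one_lt_d9
    linarith
  have h := Literature.Analysis.Complex.norm_logDeriv_sub_sum_le (f := riemannZeta₁) (c := 2 + (t : ℂ) * I)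
    (r := 7 / 4) (r₁ := 9 / 5) (R₂ := 37 / 20) (R := 39 / 20) (B := 21 * (|t| + 4) ^ 2)
    (by norm_num) (by norm_num) (by norm_num) (by norm_num)
    (fun z _ ↦ differentiable_riemannZeta₁.analyticAt z) (riemannZeta₁_two_add_ne_zero t)
    (fun z hz ↦ norm_riemannZeta₁_le_of_mem_closedBall t hz) hs hζ
  -- the sums in `h` are over `zetaDiscZeros t` with the weights `zetaDiscDivisor t`
  change ‖logDeriv riemannZeta₁ s - ∑ ρ ∈ zetaDiscZeros t, (zetaDiscDivisor t ρ : ℂ) / (s - ρ)‖ ≤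
    K * (Real.log (21 * (|t| + 4) ^ 2 / ‖riemannZeta₁ (2 + t * I)‖) +
      (∑ ρ ∈ zetaDiscZeros t, (zetaDiscDivisor t ρ : ℝ)) * L₀ + 1) at h
  refine h.trans ?_
  have hL := log_bound_div_norm_le t
  rw [← hA₀] at hL
  have hN := hC₂ t
  have hsum0 : 0 ≤ ∑ ρ ∈ zetaDiscZeros t, (zetaDiscDivisor t ρ : ℝ) :=
    Finset.sum_nonneg fun ρ _ ↦ by exact_mod_cast zetaDiscDivisor_nonneg t ρ
  calc K * (Real.log (21 * (|t| + 4) ^ 2 / ‖riemannZeta₁ (2 + t * I)‖) +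
        (∑ ρ ∈ zetaDiscZeros t, (zetaDiscDivisor t ρ : ℝ)) * L₀ + 1)
      ≤ K * (A₀ * Real.log (|t| + 4) + (C₂ * Real.log (|t| + 4)) * L₀ + 1) := by gcongr
    _ ≤ K * (A₀ * Real.log (|t| + 4) + (C₂ * Real.log (|t| + 4)) * L₀ + Real.log (|t| + 4)) := by
        gcongr
    _ = K * (A₀ + C₂ * L₀ + 1) * Real.log (|t| + 4) := by ring

/-- The point `σ + it` with `1/4 ≤ σ ≤ 2` lies in the disc `|s − (2 + it)| ≤ 7/4`. [folklore] -/
theorem mem_closedBall_of_re_mem_Icc {σ : ℝ} (hσ : σ ∈ Icc (1 / 4 : ℝ) 2) (t : ℝ) :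
    (σ : ℂ) + t * I ∈ closedBall (2 + (t : ℂ) * I) (7 / 4) := by
  rw [mem_closedBall, dist_eq_norm, show (σ : ℂ) + t * I - (2 + t * I) = ((σ - 2 : ℝ) : ℂ) by
    push_cast; ring, norm_real, Real.norm_eq_abs, abs_le]
  constructor <;> linarith [hσ.1, hσ.2]

end Literature.NumberTheory.LFunctions

end
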